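import Summits.AnomalousDissipation.AnomalousDissipation.Theorems.MomentParityQuarticGateAxialQuadKill

/-!
# The ISOLATION LEMMA for the cubic-Casimir cores
# (line `axis-sectors` of crux `MomentParity.QuarticGate`, stmt-AnomalousDissipation-11464)

Rank-3 tensor form of the pair-transfer surjectivity (block-killing) lemma
`QuarticGate.Negative.eq_zero_of_forall_pair_transfer` (real, `…/QuarticGate/Negative/SelectionRule`)
/ `MomentParityQuarticGate.AxialQuad.eq_zero_of_forall_pair_transfer_complex` (its complexification,
`…AxialQuadKill`, on which this file is built), in the shape consumed by the registered sub-goals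
`cubicCoreCentre`, `cubicCoreOffCentre` of stmt-AnomalousDissipation-11464.

Setting. A coefficient block `G : Fin 3 → Fin 3 → Fin 3 → ℂ` (think `G = Γ (p+q) k₂ k₃`) is
TRANSVERSAL in its first slot with respect to `ℓ = p + q` (`Σₐ G a b c (pₐ + qₐ) = 0`), and the
invariance identity of the induction feeds that slot only through the PAIR TRANSFERS
`τ(x,y) = (x·q) y + (y·p) x` of amplitudes `x ⊥ p`, `y ⊥ q` (wavevectors cast `ℤ → ℂ`, bilinear dot
products), the other two slots being fed by arbitrary transverse `u ⊥ k₂`, `v ⊥ k₃`: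
`Σ G a b c τ(x,y)ₐ u_b v_c = 0`.

* `cubicIsolation_contract_eq_zero` — for `p × q ≠ 0`, `|p|² ≠ |q|²` the contraction
  `gₐ = Σ_{b,c} G a b c u_b v_c` vanishes for all transverse `u, v`: `g ⊥ p + q` by slot
  transversality, `g` annihilates all pair transfers by the fed identity, so `g = 0` by the complex
  block-killing lemma;
* `cubicIsolation_int` — hence `Σ G a b c zₐ u_b v_c = 0` for ALL `z ∈ ℂ³` (integer hypotheses
  `p ⨯₃ q ≠ 0`, `p ⬝ᵥ p ≠ q ⬝ᵥ q`);
* `cubicIsolation` — the REGISTERED form (hypotheses over `ℝ`: `↑p ⨯₃ ↑q ≠ 0`,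
  `Σ (pᵢ)² ≠ Σ (qᵢ)²`, and a redundant `z ⊥ p + q`), `cubicIsolation_all` without the `z`
  hypothesis;
* `sum_mul_intCast_add_eq_zero_of_slot`, `cubicIsolation_slot`, `cubicIsolation_slot_real` — the
  same for a slot `G = Γ (p + q) k₂ k₃` of a big tensor `Γ` transversal in its first slot.

Pure finite-dimensional algebra; supports stmt-AnomalousDissipation-11464, asserts nothing about the
route's statements.
-/

namespace Summit.AnomalousDissipation.AnomalousDissipation.Theorems.MomentParityQuarticGate

open Matrix

-- `Summit.<Summit>.<Problem>` is the tree's mandated summit-side namespace (CONVENTIONS §2); for this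
-- single-conjunct summit the two coincide, so the duplicate is deliberate.
set_option linter.dupNamespace false

/-! ## Casting the hypotheses: `ℝ`-forms versus `ℤ`-forms -/

/-- The cross product commutes with the cast `ℤ³ → ℝ³`. [folklore] -/
theorem intCast_cross_intCast_real (p q : Fin 3 → ℤ) :
    (fun i => (p i : ℝ)) ⨯₃ (fun i => (q i : ℝ)) = fun i => ((p ⨯₃ q) i : ℝ) := by
  funext i; fin_cases i <;> simp [cross_apply]

/-- Non-collinearity over `ℝ` is non-collinearity over `ℤ`: `↑p ⨯₃ ↑q ≠ 0 ↔ p ⨯₃ q ≠ 0`.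
[folklore] -/
theorem real_cross_ne_zero_iff (p q : Fin 3 → ℤ) :
    (fun i => (p i : ℝ)) ⨯₃ (fun i => (q i : ℝ)) ≠ 0 ↔ p ⨯₃ q ≠ 0 := by
  rw [intCast_cross_intCast_real, not_iff_not]
  constructor
  · intro h
    funext i
    simpa using congrFun h i
  · intro h
    rw [h]
    funext i
    simp

/-- Unequal lengths over `ℝ` is unequal lengths over `ℤ`: `Σ (pᵢ)² ≠ Σ (qᵢ)² ↔ p ⬝ᵥ p ≠ q ⬝ᵥ q`.
[folklore] -/
theorem real_normSq_ne_iff (p q : Fin 3 → ℤ) :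
    (∑ i, (p i : ℝ) ^ 2) ≠ (∑ i, (q i : ℝ) ^ 2) ↔ p ⬝ᵥ p ≠ q ⬝ᵥ q := by
  have hp : (∑ i, (p i : ℝ) ^ 2) = ((p ⬝ᵥ p : ℤ) : ℝ) := by
    push_cast [dotProduct]
    exact Finset.sum_congr rfl fun i _ => sq _
  have hq : (∑ i, (q i : ℝ) ^ 2) = ((q ⬝ᵥ q : ℤ) : ℝ) := by
    push_cast [dotProduct]
    exact Finset.sum_congr rfl fun i _ => sq _
  rw [hp, hq, not_iff_not, Int.cast_inj]

/-! ## The isolation lemma -/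

/-- **Isolation lemma, contracted form.** For an unequal (`p ⬝ᵥ p ≠ q ⬝ᵥ q`) non-collinear
(`p ⨯₃ q ≠ 0`) integer pair and a block `G` transversal to `p + q` in its first slot, if the pair
transfers `(x·q) y + (y·p) x` (`x ⊥ p`, `y ⊥ q`) fed into the first slot kill `G` against all
transverse `u ⊥ k₂`, `v ⊥ k₃`, then the contraction `a ↦ Σ_{b,c} G a b c u_b v_c` vanishes for all
such `u, v`. [folklore] -/
theorem cubicIsolation_contract_eq_zero (p q k₂ k₃ : Fin 3 → ℤ) (G : Fin 3 → Fin 3 → Fin 3 → ℂ)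
    (hn : p ⨯₃ q ≠ 0) (hlen : p ⬝ᵥ p ≠ q ⬝ᵥ q)
    (htrans : ∀ b c, ∑ a, G a b c * ((p a : ℂ) + (q a : ℂ)) = 0)
    (hfed : ∀ x y u v : Fin 3 → ℂ, (∑ d, (p d : ℂ) * x d = 0) → (∑ d, (q d : ℂ) * y d = 0) →
      (∑ d, (k₂ d : ℂ) * u d = 0) → (∑ d, (k₃ d : ℂ) * v d = 0) →
      ∑ a, ∑ b, ∑ c, G a b c * ((∑ d, x d * (q d : ℂ)) * y a + (∑ d, y d * (p d : ℂ)) * x a)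
        * u b * v c = 0)
    (u v : Fin 3 → ℂ) (hu : ∑ d, (k₂ d : ℂ) * u d = 0) (hv : ∑ d, (k₃ d : ℂ) * v d = 0) :
    (fun a => ∑ b, ∑ c, G a b c * u b * v c) = 0 := by
  have hn' : ((fun i : Fin 3 => ((p i : ℤ) : ℂ)) ⨯₃ (fun i : Fin 3 => ((q i : ℤ) : ℂ))) ⬝ᵥ
      ((fun i : Fin 3 => ((p i : ℤ) : ℂ)) ⨯₃ (fun i : Fin 3 => ((q i : ℤ) : ℂ))) ≠ 0 := by
    rw [AxialQuad.castVec_cross_castVec]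
    exact AxialQuad.castVec_dotProduct_self_ne_zero hn
  have hlen' : (fun i : Fin 3 => ((p i : ℤ) : ℂ)) ⬝ᵥ (fun i : Fin 3 => ((p i : ℤ) : ℂ)) ≠
      (fun i : Fin 3 => ((q i : ℤ) : ℂ)) ⬝ᵥ (fun i : Fin 3 => ((q i : ℤ) : ℂ)) := by
    rw [AxialQuad.castVec_dotProduct_castVec, AxialQuad.castVec_dotProduct_castVec]
    exact_mod_cast hlen
  refine AxialQuad.eq_zero_of_forall_pair_transfer_complex (fun i : Fin 3 => ((p i : ℤ) : ℂ))
    (fun i : Fin 3 => ((q i : ℤ) : ℂ)) _ hn' hlen' ?_ fun x y hx hy => ?_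
  · -- `g ⊥ p + q` from the slot transversality
    calc (fun a => ∑ b, ∑ c, G a b c * u b * v c) ⬝ᵥ
          ((fun i : Fin 3 => ((p i : ℤ) : ℂ)) + (fun i : Fin 3 => ((q i : ℤ) : ℂ)))
          = ∑ b, ∑ c, (∑ a, G a b c * ((p a : ℂ) + (q a : ℂ))) * (u b * v c) := by
            simp only [dotProduct, Pi.add_apply, Finset.sum_mul]
            rw [Finset.sum_comm]
            refine Finset.sum_congr rfl fun b _ => ?_
            rw [Finset.sum_comm]
            refine Finset.sum_congr rfl fun c _ => Finset.sum_congr rfl fun a _ => ?_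
            ring
      _ = 0 := by simp [htrans]
  · -- `g` annihilates the pair transfers, by the fed identity
    have hx' : ∑ d, (p d : ℂ) * x d = 0 := by rw [dotProduct_comm] at hx; exact hx
    have hy' : ∑ d, (q d : ℂ) * y d = 0 := by rw [dotProduct_comm] at hy; exact hy
    have h := hfed x y u v hx' hy' hu hv
    rw [← h]
    simp only [dotProduct, Pi.add_apply, Pi.smul_apply, smul_eq_mul, Finset.sum_mul]
    refine Finset.sum_congr rfl fun a _ => Finset.sum_congr rfl fun b _ =>
      Finset.sum_congr rfl fun c _ => ?_
    ring

/-- **Isolation lemma, integer hypotheses.** Under the hypotheses of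
`cubicIsolation_contract_eq_zero`, `Σ_{a,b,c} G a b c zₐ u_b v_c = 0` for EVERY `z ∈ ℂ³` and all
transverse `u ⊥ k₂`, `v ⊥ k₃`. [folklore] -/
theorem cubicIsolation_int (p q k₂ k₃ : Fin 3 → ℤ) (G : Fin 3 → Fin 3 → Fin 3 → ℂ)
    (hn : p ⨯₃ q ≠ 0) (hlen : p ⬝ᵥ p ≠ q ⬝ᵥ q)
    (htrans : ∀ b c, ∑ a, G a b c * ((p a : ℂ) + (q a : ℂ)) = 0)
    (hfed : ∀ x y u v : Fin 3 → ℂ, (∑ d, (p d : ℂ) * x d = 0) → (∑ d, (q d : ℂ) * y d = 0) →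
      (∑ d, (k₂ d : ℂ) * u d = 0) → (∑ d, (k₃ d : ℂ) * v d = 0) →
      ∑ a, ∑ b, ∑ c, G a b c * ((∑ d, x d * (q d : ℂ)) * y a + (∑ d, y d * (p d : ℂ)) * x a)
        * u b * v c = 0)
    (z u v : Fin 3 → ℂ) (hu : ∑ d, (k₂ d : ℂ) * u d = 0) (hv : ∑ d, (k₃ d : ℂ) * v d = 0) :
    ∑ a, ∑ b, ∑ c, G a b c * z a * u b * v c = 0 := by
  have h := cubicIsolation_contract_eq_zero p q k₂ k₃ G hn hlen htrans hfed u v hu hv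
  have h' : ∀ a, ∑ b, ∑ c, G a b c * u b * v c = 0 := fun a => congrFun h a
  calc ∑ a, ∑ b, ∑ c, G a b c * z a * u b * v c
        = ∑ a, z a * ∑ b, ∑ c, G a b c * u b * v c := by
          refine Finset.sum_congr rfl fun a _ => ?_
          rw [Finset.mul_sum]
          refine Finset.sum_congr rfl fun b _ => ?_
          rw [Finset.mul_sum]
          refine Finset.sum_congr rfl fun c _ => ?_
          ring
    _ = 0 := by simp [h']

/-- **Isolation lemma, all `z`.** As `cubicIsolation` (hypotheses over `ℝ`), with the conclusion for
every `z ∈ ℂ³`, not only `z ⊥ p + q`. [folklore] -/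
theorem cubicIsolation_all (p q k₂ k₃ : Fin 3 → ℤ) (G : Fin 3 → Fin 3 → Fin 3 → ℂ)
    (hn : (fun i => (p i : ℝ)) ⨯₃ (fun i => (q i : ℝ)) ≠ 0)
    (hlen : (∑ i, (p i : ℝ) ^ 2) ≠ (∑ i, (q i : ℝ) ^ 2))
    (htrans : ∀ b c, ∑ a, G a b c * ((p a : ℂ) + (q a : ℂ)) = 0)
    (hfed : ∀ x y u v : Fin 3 → ℂ, (∑ d, (p d : ℂ) * x d = 0) → (∑ d, (q d : ℂ) * y d = 0) →
      (∑ d, (k₂ d : ℂ) * u d = 0) → (∑ d, (k₃ d : ℂ) * v d = 0) →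
      ∑ a, ∑ b, ∑ c, G a b c * ((∑ d, x d * (q d : ℂ)) * y a + (∑ d, y d * (p d : ℂ)) * x a)
        * u b * v c = 0)
    (z u v : Fin 3 → ℂ) (hu : ∑ d, (k₂ d : ℂ) * u d = 0) (hv : ∑ d, (k₃ d : ℂ) * v d = 0) :
    ∑ a, ∑ b, ∑ c, G a b c * z a * u b * v c = 0 :=
  cubicIsolation_int p q k₂ k₃ G ((real_cross_ne_zero_iff p q).1 hn)
    ((real_normSq_ne_iff p q).1 hlen) htrans hfed z u v hu hv

/-- **The isolation lemma** (registered sub-goal `cubicIsolation` of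
stmt-AnomalousDissipation-11464).
For integer wavevectors `p, q` with `↑p ⨯₃ ↑q ≠ 0` and `Σ (pᵢ)² ≠ Σ (qᵢ)²`, a block `G` transversal
to `p + q` in its first slot and killed, against all transverse `u ⊥ k₂`, `v ⊥ k₃`, by every pair
transfer `(x·q) y + (y·p) x` (`x ⊥ p`, `y ⊥ q`) fed into the first slot, is killed by every
`z ⊥ p + q` (indeed by every `z`, `cubicIsolation_all`): the pair transfers of an unequal
non-collinear pair project ONTO `(p+q)⊥`. [folklore] -/
theorem cubicIsolation : ∀ (p q k₂ k₃ : Fin 3 → ℤ) (G : Fin 3 → Fin 3 → Fin 3 → ℂ),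
    crossProduct (fun i => (p i : ℝ)) (fun i => (q i : ℝ)) ≠ 0 →
    (∑ i, (p i : ℝ) ^ 2) ≠ (∑ i, (q i : ℝ) ^ 2) →
    (∀ b c, ∑ a, G a b c * ((p a : ℂ) + (q a : ℂ)) = 0) →
    (∀ x y u v : Fin 3 → ℂ, (∑ d, (p d : ℂ) * x d = 0) → (∑ d, (q d : ℂ) * y d = 0) →
        (∑ d, (k₂ d : ℂ) * u d = 0) → (∑ d, (k₃ d : ℂ) * v d = 0) →
        ∑ a, ∑ b, ∑ c, G a b c * ((∑ d, x d * (q d : ℂ)) * y a + (∑ d, y d * (p d : ℂ)) * x a)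
          * u b * v c = 0) →
    ∀ z u v : Fin 3 → ℂ, (∑ d, ((p d : ℂ) + (q d : ℂ)) * z d = 0) → (∑ d, (k₂ d : ℂ) * u d = 0) →
      (∑ d, (k₃ d : ℂ) * v d = 0) →
      ∑ a, ∑ b, ∑ c, G a b c * z a * u b * v c = 0 :=
  fun p q k₂ k₃ G hn hlen htrans hfed z u v _ hu hv =>
    cubicIsolation_all p q k₂ k₃ G hn hlen htrans hfed z u v hu hv

/-! ## Slot form: `G = Γ (p + q) k₂ k₃` -/

/-- Slot-1 transversality of the block `Γ (p + q) k₂ k₃` of a tensor transversal in its first slot: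
`Σₐ Γ (p+q) k₂ k₃ a b c (pₐ + qₐ) = 0`. [folklore] -/
theorem sum_mul_intCast_add_eq_zero_of_slot
    (Γ : (Fin 3 → ℤ) → (Fin 3 → ℤ) → (Fin 3 → ℤ) → Fin 3 → Fin 3 → Fin 3 → ℂ)
    (hΓtrans : ∀ p' q' r' b c, ∑ a, Γ p' q' r' a b c * (p' a : ℂ) = 0) (p q k₂ k₃ : Fin 3 → ℤ)
    (b c : Fin 3) : ∑ a, Γ (p + q) k₂ k₃ a b c * ((p a : ℂ) + (q a : ℂ)) = 0 := by
  simpa only [Pi.add_apply, Int.cast_add] using hΓtrans (p + q) k₂ k₃ b c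

/-- **Isolation lemma for a tensor slot, integer hypotheses.** For `Γ` transversal in its first
slot, an unequal non-collinear integer pair `(p, q)` whose pair transfers, fed into the first slot
of the block `Γ (p+q) k₂ k₃`, kill it against all transverse `u ⊥ k₂`, `v ⊥ k₃`, isolates that
block: `Σ Γ (p+q) k₂ k₃ a b c zₐ u_b v_c = 0` for all `z` and all transverse `u, v`. [folklore] -/
theorem cubicIsolation_slot
    (Γ : (Fin 3 → ℤ) → (Fin 3 → ℤ) → (Fin 3 → ℤ) → Fin 3 → Fin 3 → Fin 3 → ℂ)
    (hΓtrans : ∀ p' q' r' b c, ∑ a, Γ p' q' r' a b c * (p' a : ℂ) = 0) (p q k₂ k₃ : Fin 3 → ℤ)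
    (hn : p ⨯₃ q ≠ 0) (hlen : p ⬝ᵥ p ≠ q ⬝ᵥ q)
    (hfed : ∀ x y u v : Fin 3 → ℂ, (∑ d, (p d : ℂ) * x d = 0) → (∑ d, (q d : ℂ) * y d = 0) →
      (∑ d, (k₂ d : ℂ) * u d = 0) → (∑ d, (k₃ d : ℂ) * v d = 0) →
      ∑ a, ∑ b, ∑ c, Γ (p + q) k₂ k₃ a b c *
        ((∑ d, x d * (q d : ℂ)) * y a + (∑ d, y d * (p d : ℂ)) * x a) * u b * v c = 0)
    (z u v : Fin 3 → ℂ) (hu : ∑ d, (k₂ d : ℂ) * u d = 0) (hv : ∑ d, (k₃ d : ℂ) * v d = 0) :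
    ∑ a, ∑ b, ∑ c, Γ (p + q) k₂ k₃ a b c * z a * u b * v c = 0 :=
  cubicIsolation_int p q k₂ k₃ (Γ (p + q) k₂ k₃) hn hlen
    (sum_mul_intCast_add_eq_zero_of_slot Γ hΓtrans p q k₂ k₃) hfed z u v hu hv

/-- **Isolation lemma for a tensor slot, real hypotheses** (`↑p ⨯₃ ↑q ≠ 0` in `ℝ³`,
`Σ (pᵢ)² ≠ Σ (qᵢ)²`, i.e. `freqNormSq p ≠ freqNormSq q` unfolded). [folklore] -/
theorem cubicIsolation_slot_real
    (Γ : (Fin 3 → ℤ) → (Fin 3 → ℤ) → (Fin 3 → ℤ) → Fin 3 → Fin 3 → Fin 3 → ℂ)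
    (hΓtrans : ∀ p' q' r' b c, ∑ a, Γ p' q' r' a b c * (p' a : ℂ) = 0) (p q k₂ k₃ : Fin 3 → ℤ)
    (hn : (fun i => (p i : ℝ)) ⨯₃ (fun i => (q i : ℝ)) ≠ 0)
    (hlen : (∑ i, (p i : ℝ) ^ 2) ≠ (∑ i, (q i : ℝ) ^ 2))
    (hfed : ∀ x y u v : Fin 3 → ℂ, (∑ d, (p d : ℂ) * x d = 0) → (∑ d, (q d : ℂ) * y d = 0) →
      (∑ d, (k₂ d : ℂ) * u d = 0) → (∑ d, (k₃ d : ℂ) * v d = 0) →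
      ∑ a, ∑ b, ∑ c, Γ (p + q) k₂ k₃ a b c *
        ((∑ d, x d * (q d : ℂ)) * y a + (∑ d, y d * (p d : ℂ)) * x a) * u b * v c = 0)
    (z u v : Fin 3 → ℂ) (hu : ∑ d, (k₂ d : ℂ) * u d = 0) (hv : ∑ d, (k₃ d : ℂ) * v d = 0) :
    ∑ a, ∑ b, ∑ c, Γ (p + q) k₂ k₃ a b c * z a * u b * v c = 0 :=
  cubicIsolation_slot Γ hΓtrans p q k₂ k₃ ((real_cross_ne_zero_iff p q).1 hn)
    ((real_normSq_ne_iff p q).1 hlen) hfed z u v hu hv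

end Summit.AnomalousDissipation.AnomalousDissipation.Theorems.MomentParityQuarticGate
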